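import Literature.AlgebraicGeometry.HodgeTheory.AlgebraicCechDeRhamAffinePieces
import Literature.Geometry.Kaehler.CechHolomorphicDeRham
import HarnessLib

/-!
# The algebraic Čech–de Rham complex realised in the holomorphic one: Route P modulo GAGA on the rows and the holomorphic Poincaré lemma on the pieces

[topic AlgebraicGeometry/HodgeTheory]

Grothendieck, *On the de Rham cohomology of algebraic varieties* (Publ. IHÉS 29 (1966)), p. 97, after
reducing Theorem 1′ (the comparison `H(X) → H(X^h, ℂ)` is an isomorphism) to Theorem 1 on the affine
pieces of a cover: "Besides, if `X` is complete, then we can prove theorem 1′ directly, using the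
spectral sequence (3) [`E₁ = H^q(X, Ω^p) ⇒ H(X)`] and the analogous one for `X^h`, and using Serre's
GAGA; thus in this case, the result is elementary i.e. does not use resolution, as does th. 1." The
same argument in El Zein–Tu's chapter (Cattani–El Zein–Griffiths–Lê (2014), Ch. 2, Thm. 2.6.1 with
(2.3.1) GAGA and §2.9.2: the algebraic / analytic Čech–de Rham complexes of an affine cover, "by
Cartan's theorem B (because a complex affine variety with the complex topology is Stein)").

This file TYPES that route on the tree's carriers. For a smooth `X` over `ℂ` with an affine open
cover `𝔘` charted by `C : CoverCharts X U` and an analytic model `A` of `X`: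

* `isOfType_polyFormRealize`, `isHolomorphicForm_regularFormRealize` — **the holomorphic image (5)
  of a regular `q`-form on an affine scheme is a holomorphic `q`-form** on its analytic model (smooth,
  of type `(q,0)` — `d` of a regular function is of type `(1,0)` because regular functions are
  holomorphic (`AnalyticModel.mdifferentiable_regularFun`, [SerreGAGA1956, §2]), wedges of
  `(1,0)`-forms are of type `(q,0)` — and `∂̄`-closed because its `d` is the image of the algebraic
  `d`, again of pure type) [Grothendieck1966, (5)];
* `AnalyticModel.realizeOn_mem_holomorphicFormsOn` — on an affine open piece `O` the realisation
  extended by zero lies in `Ω^q_hol(ψ⁻¹O(ℂ))` (`holomorphicFormsOn` of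
  `Geometry/Kaehler/CechHolomorphicDeRham.lean`);
* **`CoverCharts.realizeHolHom A : Č(𝔘, Ω•_alg) → C(𝔘^an, Ω•_hol)`** — the realisation morphism
  `CoverCharts.realizeHom` FACTORS through the holomorphic Čech–de Rham double complex
  `cechHolDeRham` of the analytic cover (`cechHolDeRhamIncl_f_realizeHolHom_f`);
* **`CoverCharts.bijective_realizeTotCohMap_of_rows_of_pieces`** — Route P assembled modulo its two
  analytic nodes, as inline binders: IF (rows, node P3 = GAGA + Leray on both sides,
  [SerreGAGA1956, §3 n°12 Thm. 1]) for every form degree `q` the Čech cochain map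
  `C•(𝔘, Ω^q_alg) → C•(𝔘^an, Ω^q_hol)` is a quasi-isomorphism, AND (pieces, node P4 = the holomorphic
  Poincaré lemma with Cartan's Theorem B on the Stein pieces, [CarlsonMullerStachPeters2017, §6.2])
  for every finite intersection `U_J` the inclusion `Ω•_hol(ψ⁻¹U_J(ℂ)) ↪ A•(ψ⁻¹U_J(ℂ))` is a
  quasi-isomorphism, THEN `realizeTotCohMap A n : Hⁿ(Tot Č(𝔘, Ω_alg)) → Hⁿ(Tot C(𝔘^an, A))` is
  bijective for every `n` (`ADoubleComplex.Hom.bijective_totCohMap_of_codRestrict_rows_incl_cols`: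
  Kashiwara–Schapira (2006), Thm. 12.5.4 on the rows of `realizeHolHom` and on the columns of the
  inclusion);
* `CoverCharts.bijective_realizeDeRham_of_rows_of_pieces`, and
  **`exists_isConjugateClass_of_rows_of_pieces`** — hence, for `X` smooth PROJECTIVE, `σ`-conjugate
  classes exist in every degree (`IsConjugateClass`; the torsor step
  `exists_isConjugateClass_of_surjective_realizeDeRham`).

Everything is proved; one definition with body (`realizeHolHom`, a co-restriction); no named facts
(net debt 0). NOT here: the two binders themselves (GAGA for `Ω^q` on projective `X`; the holomorphic
Poincaré lemma / Theorem B on the affine pieces).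

## References

* [Grothendieck1966] A. Grothendieck, *On the de Rham cohomology of algebraic varieties*, Publ. Math.
  IHÉS 29 (1966), p. 96–97 ((5), (6), Thm. 1′ and the remark on the complete case).
* [CattaniElZeinGriffithsLe2014] E. Cattani, F. El Zein, P. Griffiths, Lê D. T. (eds.), *Hodge
  Theory* (2014), Ch. 2, Thm. 2.6.1, (2.3.1), §2.9.2.
* [SerreGAGA1956] J.-P. Serre, *Géométrie algébrique et géométrie analytique* (1956), §2, §3 n°12.
* [CarlsonMullerStachPeters2017] J. Carlson, S. Müller-Stach, C. Peters, *Period Mappings and Period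
  Domains* (2017), §3.1 Thm. 3.1.5, §6.2.
* [KashiwaraSchapira2006] M. Kashiwara, P. Schapira, *Categories and Sheaves* (2006), Thm. 12.5.4.
* [CharlesSchnell2014Notes] F. Charles, C. Schnell, *Notes on absolute Hodge classes*, §11.2.2.
-/

noncomputable section

universe u

open scoped Manifold ContDiff Topology
open Set Function CategoryTheory AlgebraicGeometry MvPolynomial TopologicalSpace
open Literature.Algebra.Homology Literature.Geometry.Kaehler Literature.NumberTheory.Transcendental
open Literature.AlgebraicGeometry.Motives Literature.AlgebraicGeometry.Motives.AffineDeRham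

/-! ### Types: extension by zero, iterated differentials of holomorphic functions -/

namespace Literature.Geometry.Kaehler

section Types

variable {E : Type*} [NormedAddCommGroup E] [NormedSpace ℂ E]
  {M : Type*} [TopologicalSpace M] [ChartedSpace E M] {k : ℕ}

/-- Extension by zero from an open submanifold preserves the type (the rotations `e^{iθ}` of
`T_m U = T_m M = E` are the same). [cite: VoisinHodgeI2002, §2.3.1] -/
theorem _root_.Literature.NumberTheory.Transcendental.IsOfType.extendZero {U : Opens M} {p q : ℕ}
    {β : MForm 𝓘(ℝ, E) U ℂ k} (h : IsOfType p q β) : IsOfType p q β.extendZero := by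
  refine ⟨h.1, fun m θ v ↦ ?_⟩
  by_cases hm : m ∈ U
  · rw [MForm.extendZero_apply_of_mem β hm]
    exact h.2 ⟨m, hm⟩ θ v
  · rw [MForm.extendZero_apply_of_notMem β hm]
    simp

/-- The degree cast preserves types (private copy of `IsOfType.castDeg_of_eq` of `DolbeaultLeibniz`,
whose import closure is not wanted here). [cite: VoisinHodgeI2002, §2.3.1] -/
private theorem isOfType_castDeg' {k' p q : ℕ} (h : k = k') {α : MForm 𝓘(ℝ, E) M ℂ k}
    (hα : IsOfType p q α) : IsOfType p q (α.castDeg h) := by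
  subst h
  exact hα

/-- Re-indexing the first type index along an equality of naturals. [folklore] -/
private theorem isOfType_of_eq_fst {p p' q : ℕ} {α : MForm 𝓘(ℝ, E) M ℂ k} (hα : IsOfType p q α)
    (hp : p = p') : IsOfType p' q α := by
  subst hp
  exact hα

/-- Multiplication by a complex FUNCTION preserves the type (pointwise the type condition is
`ℂ`-linear). [cite: VoisinHodgeI2002, §2.3.1] -/
theorem _root_.Literature.NumberTheory.Transcendental.IsOfType.fun_smul_complex {p q : ℕ}
    {α : MForm 𝓘(ℝ, E) M ℂ k} (hα : IsOfType p q α) (f : M → ℂ) :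
    IsOfType p q (fun z ↦ f z • α z : MForm 𝓘(ℝ, E) M ℂ k) :=
  ⟨hα.1, fun x θ v ↦ by
    simp only [ContinuousAlternatingMap.smul_apply, hα.2 x θ v, smul_eq_mul]
    ring⟩

variable [IsManifold 𝓘(ℂ, E) ω M] [IsManifold 𝓘(ℝ, E) ∞ M]

/-- **`df` is of type `(1,0)` for a holomorphic function `f`** (Cauchy–Riemann: `∂̄f = (df)^{0,1} = 0`
iff `f` is holomorphic, `dolbeaultBar_eq_zero_iff_mdifferentiable_holds`; and a `1`-form is of type
`(1,0)` iff its `(0,1)`-part vanishes). [cite: VoisinHodgeI2002, §2.3.3 Lemma 2.29] -/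
theorem isOfType_one_zero_mextDeriv_ofFun {f : M → ℂ} (hf : ContMDiff 𝓘(ℝ, E) 𝓘(ℝ, ℂ) 1 f)
    (hh : MDifferentiable 𝓘(ℂ, E) 𝓘(ℂ, ℂ) f) :
    IsOfType 1 0 (mextDeriv (MForm.ofFun 𝓘(ℝ, E) f)) := by
  rw [← typeComponent_zero_one_eq_zero_iff_isOfType, ← dolbeaultBar_eq_typeComponent_mextDeriv]
  exact (dolbeaultBar_eq_zero_iff_mdifferentiable_holds hf :
    dolbeaultBar (MForm.ofFun 𝓘(ℝ, E) f) = 0 ↔ MDifferentiable 𝓘(ℂ, E) 𝓘(ℂ, ℂ) f).2 hh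

end Types

end Literature.Geometry.Kaehler

namespace Literature.AlgebraicGeometry.HodgeTheory

section HodgeTheory

variable {E : Type} [NormedAddCommGroup E] [NormedSpace ℂ E] [FiniteDimensional ℂ E] {m : ℕ}

/-! ### The holomorphic image of a regular form is a holomorphic form -/

section Affine

variable {Y : Motives.SchemeOver ℂ} [IsAffine Y.left] (B : AnalyticModel E m Y) {N : ℕ}
  (x : Fin N → Γ(Y.left, ⊤))

/-- `d` of a regular function, read on `Y^an`, is of type `(1,0)` (regular functions are holomorphic
on the analytification). [cite: SerreGAGA1956, §2] -/
theorem isOfType_dFun_regularFun (s : Γ(Y.left, ⊤)) :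
    IsOfType 1 0 (dFun (B.regularFun s) : MForm 𝓘(ℝ, E) B.carrier ℂ 1) :=
  isOfType_one_zero_mextDeriv_ofFun ((B.contMDiff_regularFun s).of_le (by norm_cast))
    (B.mdifferentiable_regularFun s)

omit [IsAffine Y.left] in
/-- An iterated differential `dg₀ ∧ ⋯ ∧ dg_{k-1}` of functions with `dgᵢ` of type `(1,0)` is of type
`(k,0)` (types add under `∧`, `IsOfType.wedge_holds`). [cite: VoisinHodgeI2002, §2.3.1] -/
theorem isOfType_dWedge {k : ℕ} {g : Fin k → B.carrier → ℂ}
    (hg : ∀ i, IsOfType 1 0 (dFun (g i) : MForm 𝓘(ℝ, E) B.carrier ℂ 1)) :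
    IsOfType k 0 (dWedge k g : MForm 𝓘(ℝ, E) B.carrier ℂ k) := by
  induction k with
  | zero => exact isOfType_zero_zero_deg0 _
  | succ k ih =>
    have h := IsOfType.wedge_holds (hg 0) (ih (fun i ↦ hg i.succ))
    exact isOfType_of_eq_fst (isOfType_castDeg' (Nat.add_comm 1 k) h) (Nat.add_comm 1 k)

/-- The analytic monomial form `dx_{t 0}^an ∧ ⋯ ∧ dx_{t (p-1)}^an` is of type `(p,0)`.
[cite: Grothendieck1966, (5)] -/
theorem isOfType_coordWedge (p : ℕ) (t : Fin p → Fin N) : IsOfType p 0 (coordWedge B x p t) :=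
  isOfType_dWedge B fun i ↦ isOfType_dFun_regularFun B (x (t i))

/-- The un-normalised holomorphic image of a polynomial `p`-form is of type `(p,0)`.
[cite: Grothendieck1966, (5)] -/
theorem isOfType_rawRealize (p : ℕ) (α : PolyForm ℂ N p) : IsOfType p 0 (rawRealize B x p α) := by
  refine ⟨rfl, fun z θ v ↦ ?_⟩
  rw [rawRealize_apply B x p α z, ContinuousAlternatingMap.sum_apply,
    ContinuousAlternatingMap.sum_apply, Finset.mul_sum]
  refine Finset.sum_congr rfl fun t _ ↦ ?_
  rw [ContinuousAlternatingMap.smul_apply, ContinuousAlternatingMap.smul_apply,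
    (isOfType_coordWedge B x p t).2 z θ v, smul_eq_mul, smul_eq_mul]
  ring

/-- **The holomorphic image (5) of a polynomial `p`-form is of type `(p,0)`.**
[cite: Grothendieck1966, (5)] -/
theorem isOfType_polyFormRealize (p : ℕ) (α : PolyForm ℂ N p) :
    IsOfType p 0 (polyFormRealize B x p α) := by
  rw [polyFormRealize_eq_smul]
  exact (isOfType_rawRealize B x p α).smul _

variable {I : Ideal (MvPolynomial (Fin N) ℂ)} (hI : I ≤ RingHom.ker (coordPresentation Y x))

/-- **The holomorphic image (5) of a regular `p`-form is of type `(p,0)`.** [cite: Grothendieck1966, (5)] -/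
theorem isOfType_regularFormRealize (p : ℕ) (r : RegularForm I p) :
    IsOfType p 0 (regularFormRealize B x hI p r) := by
  obtain ⟨α, rfl⟩ := RegularForm.mk_surjective I r
  rw [regularFormRealize_mk]
  exact isOfType_polyFormRealize B x p α

/-- **`∂̄` of the holomorphic image of a regular form vanishes**: `∂̄(r^an) = (d r^an)^{p,1} =
((dr)^an)^{p,1} = 0`, the image of `dr` being of pure type `(p+1,0)`. [cite: Grothendieck1966, (5)] -/
theorem dolbeaultBar_regularFormRealize (p : ℕ) (r : RegularForm I p) :
    dolbeaultBar (regularFormRealize B x hI p r) = 0 := by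
  rw [IsOfType.dolbeaultBar_eq_holds (isOfType_regularFormRealize B x hI p r), ← regularFormRealize_d]
  exact IsOfType.typeComponent_of_ne_holds (isOfType_regularFormRealize B x hI (p + 1) (RegularForm.d I r))
    (Or.inl (Nat.succ_ne_self p))

/-- **The holomorphic image (5) of a regular `p`-form on a smooth affine scheme is a HOLOMORPHIC
`p`-form on its analytification** (smooth, of type `(p,0)`, `∂̄`-closed: the tree's
`IsHolomorphicForm`) — Grothendieck's "`Ω_{X^h}` the complex of holomorphic differential forms on
`X^h`" receiving the algebraic forms. [cite: Grothendieck1966, (5)] -/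
theorem isHolomorphicForm_regularFormRealize (p : ℕ) (r : RegularForm I p) :
    IsHolomorphicForm (regularFormRealize B x hI p r) :=
  ⟨isSmoothForm_regularFormRealize B x hI p r, isOfType_regularFormRealize B x hI p r,
    dolbeaultBar_regularFormRealize B x hI p r⟩

end Affine

/-! ### On an affine open piece: the realisation lands in the holomorphic forms of the piece -/

namespace AnalyticModel

variable {Y : Motives.SchemeOver ℂ} (A : AnalyticModel E m Y) {O : Y.left.Opens}
  [IsAffine (Motives.openSubschemeOver Y O).left] {N : ℕ}
  (x : Fin N → Γ((Motives.openSubschemeOver Y O).left, ⊤))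
  {I : Ideal (MvPolynomial (Fin N) ℂ)}
  (hI : I ≤ RingHom.ker (coordPresentation (Motives.openSubschemeOver Y O) x))

/-- `realizeOn r` is of type `(q,0)` on `Y^an`. [cite: Grothendieck1966, (5)–(6)] -/
theorem isOfType_realizeOn (q : ℕ) (r : RegularForm I q) : IsOfType q 0 (A.realizeOn x hI q r) := by
  rw [realizeOn_apply]
  exact (isOfType_regularFormRealize (A.restrictOpen O) x hI q r).extendZero

/-- `(d (realizeOn r))|_W = realizeOn (dr)` on the open piece `W = ψ⁻¹O(ℂ)` (underlying forms of
`localD_localRealize`). [cite: Grothendieck1966, (5)] -/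
theorem restr_mextDeriv_realizeOn (q : ℕ) (r : RegularForm I q) :
    (mextDeriv (A.realizeOn x hI q r)).restr (A.openSet O : Set A.carrier) =
      A.realizeOn x hI (q + 1) (RegularForm.d I r) := by
  have h := congrArg Subtype.val (A.localD_localRealize x hI q r)
  simpa only [coe_localD, coe_localRealize] using h

/-- **On an affine open piece the realisation is a holomorphic form of the piece**:
`realizeOn r ∈ Ω^q_hol(ψ⁻¹O(ℂ))` (smooth on the piece, zero off it, of type `(q,0)`, and its `d_W`,
the realisation of `dr`, of type `(q+1,0)` — `mem_holomorphicFormsOn_of_isOfType_restr_mextDeriv`).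
[cite: Grothendieck1966, (5)–(6)] -/
theorem realizeOn_mem_holomorphicFormsOn (q : ℕ) (r : RegularForm I q) :
    A.realizeOn x hI q r ∈ holomorphicFormsOn E A.carrier (A.openSet O).isOpen q := by
  refine mem_holomorphicFormsOn_of_isOfType_restr_mextDeriv (A.openSet O).isOpen
    (A.realizeOn_mem_smoothFormsOn x hI q r) (A.isOfType_realizeOn x hI q r) ?_
  rw [A.restr_mextDeriv_realizeOn x hI q r]
  exact A.isOfType_realizeOn x hI (q + 1) (RegularForm.d I r)

end AnalyticModel

/-! ### The realisation factors through the holomorphic Čech–de Rham double complex -/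

namespace CoverCharts

variable {X : Motives.SchemeOver ℂ} {ι : Type u} {U : ι → X.left.Opens} (C : CoverCharts X U)
  (A : AnalyticModel E m X) [IsAffineCover U] [SmoothOfRelativeDimension m X.hom]

omit [SmoothOfRelativeDimension m X.hom] in
/-- Every component of a realised cochain is a holomorphic form of its piece.
[cite: Grothendieck1966, p. 96 (6)] -/
theorem realize_mem_holCechForms (p q : ℕ) (c : C.Forms p q) :
    C.realize A p q c ∈ holCechForms E A.carrier (A.isOpen_coverSet U) p q := by
  intro J
  have hW : cechSet (A.coverSet U) J = (A.openSet (cechOpen U J) : Set A.carrier) :=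
    A.cechSet_coverSet U J
  have h := A.realizeOn_mem_holomorphicFormsOn (C.coord J) le_rfl q (c J)
  rw [coe_realize_apply]
  revert h
  -- the two open sets agree; transport the membership along the equality of sets
  suffices hs : ∀ {W W' : Set A.carrier} (hWo : IsOpen W) (hW'o : IsOpen W') (_ : W = W')
      {β : MForm 𝓘(ℝ, E) A.carrier ℂ q},
      β ∈ holomorphicFormsOn E A.carrier hW'o q → β ∈ holomorphicFormsOn E A.carrier hWo q from
    hs (isOpen_cechSet (A.isOpen_coverSet U) J) (A.openSet (cechOpen U J)).isOpen hW
  intro W W' hWo hW'o hWW' β hβ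
  subst hWW'
  exact hβ

/-- **The realisation of the algebraic Čech–de Rham complex in the HOLOMORPHIC Čech–de Rham double
complex of the analytic cover**, `Č(𝔘, Ω•_alg) → C(𝔘^an, Ω•_hol)`: the co-restriction of
`realizeHom` (Grothendieck (1966), p. 97: the algebraic spectral sequence (3) maps to "the analogous
one for `X^h`"; El Zein–Tu, Thm. 2.6.1). [cite: Grothendieck1966, p. 96–97 (6)] -/
def realizeHolHom :
    C.cechDeRhamℝ.Hom (cechHolDeRham E A.carrier (A.isOpen_coverSet U)) :=
  (C.realizeHom A).codRestrict (K := Literature.Geometry.Kaehler.cechDeRham 𝓘(ℝ, E) ℂ (A.isOpen_coverSet U))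
    (S := holCechForms E A.carrier (A.isOpen_coverSet U))
    (hd := fun _ _ _ hc ↦ cechd_mem_holCechForms (A.isOpen_coverSet U) hc)
    (hδ := fun _ _ _ hc ↦ cechδ_mem_holCechForms (A.isOpen_coverSet U) hc) (C.realize_mem_holCechForms A)

/-- Components of `realizeHolHom`, on underlying cochains. [cite: Grothendieck1966, p. 96 (6)] -/
@[simp]
theorem coe_realizeHolHom_f_apply (p q : ℕ) (c : C.Forms p q) :
    ((C.realizeHolHom A).f p q c : CechForms 𝓘(ℝ, E) ℂ (A.coverSet U) p q) = C.realize A p q c :=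
  rfl

/-- **The factorisation** `incl ∘ realizeHol = realize`: the realisation morphism of Route P is the
composite `Č(𝔘, Ω•_alg) → C(𝔘^an, Ω•_hol) ↪ C(𝔘^an, A•)`. [cite: Grothendieck1966, p. 96–97 (6)] -/
theorem cechHolDeRhamIncl_f_realizeHolHom_f (p q : ℕ) (c : C.Forms p q) :
    (cechHolDeRhamIncl E A.carrier (A.isOpen_coverSet U)).f p q ((C.realizeHolHom A).f p q c) =
      (C.realizeHom A).f p q c :=
  rfl

/-! ### Route P modulo its analytic nodes: rows (GAGA) and pieces (holomorphic Poincaré lemma) -/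

/-- **Route P, assembled modulo P3-rows and P4-pieces** (Grothendieck (1966), p. 97: "if `X` is
complete, then we can prove theorem 1′ directly, using the spectral sequence (3) and the analogous
one for `X^h`, and using Serre's GAGA"; El Zein–Tu, Thm. 2.6.1). Let `𝔘` be an affine open cover of
the smooth `ℂ`-scheme `X`, `A` an analytic model. Suppose

* (rows — GAGA with Leray's theorem on both sides, [SerreGAGA1956, §3 n°12 Thm. 1]) for every form
  degree `q`, the realisation `C•(𝔘, Ω^q_alg) → C•(𝔘^an, Ω^q_hol)` of ČECH complexes induces
  bijections on cohomology in every Čech degree, and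
* (pieces — the holomorphic Poincaré lemma with Cartan's Theorem B on the Stein manifolds
  `ψ⁻¹U_J(ℂ)`, [CarlsonMullerStachPeters2017, §6.2]) for every finite intersection `U_J` the
  inclusion `(Ω•_hol(ψ⁻¹U_J(ℂ)), d) ↪ (A•(ψ⁻¹U_J(ℂ)), d)` induces bijections on cohomology in every
  degree.

Then the realisation `Hⁿ(Tot Č(𝔘, Ω•_alg)) → Hⁿ(Tot C(𝔘^an, A•))` is bijective for every `n`
(Kashiwara–Schapira (2006), Thm. 12.5.4 for the rows of `realizeHolHom` and the columns of the
inclusion, `ADoubleComplex.Hom.bijective_totCohMap_of_codRestrict_rows_incl_cols`).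
[cite: Grothendieck1966, p. 97] -/
theorem bijective_realizeTotCohMap_of_rows_of_pieces
    (hrows : ∀ q a, Bijective (NatCochain.Cohomology.map (d := fun i ↦ C.cechDeRhamℝ.δ i q)
      (d' := fun i ↦ (cechHolDeRham E A.carrier (A.isOpen_coverSet U)).δ i q)
      (fun i ↦ (C.realizeHolHom A).f i q) (fun i c ↦ (C.realizeHolHom A).f_δ i q c) a))
    (hpieces : ∀ {a : ℕ} (J : Fin (a + 1) → ι) (n : ℕ), Bijective (NatCochain.Cohomology.map
      (d := fun k ↦ (holomorphicLocalD E A.carrier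
        (isOpen_cechSet (A.isOpen_coverSet U) J) k).restrictScalars ℝ)
      (d' := fun k ↦ localD 𝓘(ℝ, E) ℂ k (isOpen_cechSet (A.isOpen_coverSet U) J))
      (fun k ↦ holomorphicFormsOnIncl E A.carrier (isOpen_cechSet (A.isOpen_coverSet U) J) k)
      (fun _ α ↦ holomorphicFormsOnIncl_holomorphicLocalD_restrictScalars
        (isOpen_cechSet (A.isOpen_coverSet U) J) α) n))
    (n : ℕ) : Bijective (C.realizeTotCohMap A n) :=
  (C.realizeHom A).bijective_totCohMap_of_codRestrict_rows_incl_cols (C.realize_mem_holCechForms A)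
    hrows (bijective_cohomologyMap_cechHolDeRhamIncl_of_forall_piece (A.isOpen_coverSet U) hpieces) n

/-- **Route P modulo P3-rows and P4-pieces, the pieces read on `ψ⁻¹U_J(ℂ) = A.openSet (cechOpen U J)`**
(the same open sets as the finite intersections of the analytic cover, `AnalyticModel.cechSet_coverSet`).
[cite: Grothendieck1966, p. 97] -/
theorem bijective_realizeTotCohMap_of_rows_of_openSet_pieces
    (hrows : ∀ q a, Bijective (NatCochain.Cohomology.map (d := fun i ↦ C.cechDeRhamℝ.δ i q)
      (d' := fun i ↦ (cechHolDeRham E A.carrier (A.isOpen_coverSet U)).δ i q)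
      (fun i ↦ (C.realizeHolHom A).f i q) (fun i c ↦ (C.realizeHolHom A).f_δ i q c) a))
    (hpieces : ∀ {a : ℕ} (J : Fin (a + 1) → ι) (n : ℕ), Bijective (NatCochain.Cohomology.map
      (d := fun k ↦ (holomorphicLocalD E A.carrier (A.openSet (cechOpen U J)).isOpen k).restrictScalars ℝ)
      (d' := fun k ↦ localD 𝓘(ℝ, E) ℂ k (A.openSet (cechOpen U J)).isOpen)
      (fun k ↦ holomorphicFormsOnIncl E A.carrier (A.openSet (cechOpen U J)).isOpen k)
      (fun _ α ↦ holomorphicFormsOnIncl_holomorphicLocalD_restrictScalars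
        (A.openSet (cechOpen U J)).isOpen α) n))
    (n : ℕ) : Bijective (C.realizeTotCohMap A n) :=
  C.bijective_realizeTotCohMap_of_rows_of_pieces A hrows
    (fun J n ↦ (bijective_cohomologyMap_holomorphicFormsOnIncl_iff_of_eq (A.cechSet_coverSet U J)
      (isOpen_cechSet (A.isOpen_coverSet U) J) (A.openSet (cechOpen U J)).isOpen n).2 (hpieces J n)) n

/-- **Theorem 1′ along a finite affine cover from P3-rows and P4-pieces**: the realisation map of
Route P `realizeDeRham : Hⁿ(Tot Č(𝔘, Ω•_alg)) → Hⁿ(Ω•(X^an), d)` is bijective.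
[cite: Grothendieck1966, p. 97] [cite: CattaniElZeinGriffithsLe2014, Ch. 2 Thm. 2.6.1] -/
theorem bijective_realizeDeRham_of_rows_of_pieces [Fintype ι] (hU : ⨆ i, U i = ⊤)
    (hrows : ∀ q a, Bijective (NatCochain.Cohomology.map (d := fun i ↦ C.cechDeRhamℝ.δ i q)
      (d' := fun i ↦ (cechHolDeRham E A.carrier (A.isOpen_coverSet U)).δ i q)
      (fun i ↦ (C.realizeHolHom A).f i q) (fun i c ↦ (C.realizeHolHom A).f_δ i q c) a))
    (hpieces : ∀ {a : ℕ} (J : Fin (a + 1) → ι) (n : ℕ), Bijective (NatCochain.Cohomology.map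
      (d := fun k ↦ (holomorphicLocalD E A.carrier (A.openSet (cechOpen U J)).isOpen k).restrictScalars ℝ)
      (d' := fun k ↦ localD 𝓘(ℝ, E) ℂ k (A.openSet (cechOpen U J)).isOpen)
      (fun k ↦ holomorphicFormsOnIncl E A.carrier (A.openSet (cechOpen U J)).isOpen k)
      (fun _ α ↦ holomorphicFormsOnIncl_holomorphicLocalD_restrictScalars
        (A.openSet (cechOpen U J)).isOpen α) n))
    (n : ℕ) : Bijective (C.realizeDeRham A hU n) := by
  rw [CoverCharts.realizeDeRham, LinearMap.coe_comp]
  exact (LinearEquiv.bijective _).comp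
    (C.bijective_realizeTotCohMap_of_rows_of_openSet_pieces A hrows hpieces n)

end CoverCharts

/-! ### Conjugate classes on a smooth projective `X` from P3-rows and P4-pieces -/

/-- **Conjugate classes from GAGA on the rows and the holomorphic Poincaré lemma on the pieces.**
Let `X` be smooth projective over `ℂ` with a finite affine open cover `𝔘` (charts `C`) and an
analytic model `A`. If the realisation `C•(𝔘, Ω^q_alg) → C•(𝔘^an, Ω^q_hol)` is a quasi-isomorphism for
every `q` (node P3) and `Ω•_hol(ψ⁻¹U_J(ℂ)) ↪ A•(ψ⁻¹U_J(ℂ))` is one for every finite intersection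
`U_J` (node P4), then for every `σ ∈ Aut ℂ`, every `k` and every `c ∈ Hᵏ(X(ℂ); ℂ)` there is a class
`c' ∈ Hᵏ(X^σ(ℂ); ℂ)` conjugate to `c` (`IsConjugateClass`, the existence conjunct of
`IsAbsoluteHodgeClass`) — Grothendieck's resolution-free road for complete `X`
[Grothendieck1966, p. 97] followed by the torsor step of Route P
(`exists_isConjugateClass_of_surjective_realizeDeRham`, [CharlesSchnell2014Notes, §11.2.2 (11.2.3)]).
[cite: Grothendieck1966, p. 97] [cite: CharlesSchnell2014Notes, §11.2.2 (11.2.3)] -/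
theorem exists_isConjugateClass_of_rows_of_pieces {n : ℕ} {X : Motives.SchemeOver ℂ}
    {ι : Type u} {U : ι → X.left.Opens} (hX : Motives.IsSmoothProjective n X) [Fintype ι]
    [IsAffineCover U] (hU : ⨆ i, U i = ⊤) (C : CoverCharts X U) (A : AnalyticModel E n X)
    (hrows : haveI : SmoothOfRelativeDimension n X.hom := hX.smoothOfRelativeDimension
      ∀ q a, Bijective (NatCochain.Cohomology.map (d := fun i ↦ C.cechDeRhamℝ.δ i q)
        (d' := fun i ↦ (cechHolDeRham E A.carrier (A.isOpen_coverSet U)).δ i q)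
        (fun i ↦ (C.realizeHolHom A).f i q) (fun i c ↦ (C.realizeHolHom A).f_δ i q c) a))
    (hpieces : ∀ {a : ℕ} (J : Fin (a + 1) → ι) (n : ℕ), Bijective (NatCochain.Cohomology.map
      (d := fun k ↦ (holomorphicLocalD E A.carrier (A.openSet (cechOpen U J)).isOpen k).restrictScalars ℝ)
      (d' := fun k ↦ localD 𝓘(ℝ, E) ℂ k (A.openSet (cechOpen U J)).isOpen)
      (fun k ↦ holomorphicFormsOnIncl E A.carrier (A.openSet (cechOpen U J)).isOpen k)
      (fun _ α ↦ holomorphicFormsOnIncl_holomorphicLocalD_restrictScalars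
        (A.openSet (cechOpen U J)).isOpen α) n))
    (k : ℕ) (σ : ℂ ≃+* ℂ) (c : complexBetti X k) : ∃ c', IsConjugateClass σ X k c c' := by
  haveI : SmoothOfRelativeDimension n X.hom := hX.smoothOfRelativeDimension
  refine exists_isConjugateClass_of_surjective_realizeDeRham hX hU C A k ?_ σ c
  exact (localCohomologyEquivComplexDeRham k).surjective.comp
    (C.bijective_realizeDeRham_of_rows_of_pieces A hU hrows hpieces k).2

end HodgeTheory

end Literature.AlgebraicGeometry.HodgeTheory

end
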